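import Summits.BirchSwinnertonDyer.BirchSwinnertonDyer.Theorems.SemiOrdinaryEisensteinDescentShaTwoCochainThetaExhaustion
import Summits.BirchSwinnertonDyer.BirchSwinnertonDyer.Theorems.SemiOrdinaryEisensteinDescentShaTwoCochainReadoutVanishing
import Summits.BirchSwinnertonDyer.BirchSwinnertonDyer.Theorems.SemiOrdinaryEisensteinDescentCasselsTateOfShaTwoCochain
import Summits.BirchSwinnertonDyer.BirchSwinnertonDyer.Theorems.SchneiderFreeAdditiveX3PoitouTateBidualTransport
import Literature.NumberTheory.EllipticCurves.WeilPairingTateDual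
import HarnessLib

/-!
# The Ш²-cochain bridge, the SHELL of the assembly: the levelwise Cassels–Tate fact `casselsTate_levelInputs K` for THE maps
# from ONE displayed road-B binder — «the readout functional of the exhausting `h` vanishes on `Ш¹(K, E[m])`»

Route `SemiOrdinaryEisensteinDescent` (BSD, rung W-ALL row 2·3@3), Kolyvagin column, Cassels–Tate lane: print item
`CasselsTateLevelInputsFact` (stmt-BirchSwinnertonDyer-20191 = `∀ K, casselsTate_levelInputs K`).  w3 g6's
`CasselsTateConj.casselsTate_levelInputs_of_shaTwoCochain` (p628097) reduced it, for THE canonical invariant maps, to `hPTc` (Milne I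
Thm. 4.10 (a) for `Ш²(K, E[m])` in `PTChoice` cochain form).  The Ш²-cochain bridge (memo `Cruxes/WildKolyvaginUpperAtThree/SHA2-BRIDGE-w3g7.md`)
discharges `hPTc` from cell bsd-schneider's road B; this file is the SHELL of its last step S4, composing the landed links

* p635669 `…ShaTwoCochainThetaExhaustion` — `[f] ∈ Ш²` from the admissible choice at `g = 0`, `θ_* [f] = Ψ h` for some
  `h : N₁ → C̄` (exhaustion at every `K`), and `[f] = 0 ⟸ Ψ h = 0` (`θ = desc^♭` an isomorphism);
* p638229 `…ShaTwoCochainReadoutVanishing` — (vii-THR) `Ψ h = 0 ⟸` the road-B readout functional of `h` vanishes on `Ш¹`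
  (annihilator of `Ш¹` = local sums, (R3), (R4), `α¹ ∘ ∂` separating; THE maps, door-c5's bridge `nat := −(Φ⁻¹ ∘ H¹(κ))`),

into two reductions of `casselsTate_levelInputs K` to ONE displayed binder each:

* `casselsTate_levelInputs_of_psi_eq_zero` — binder «for every `f` with `hPTc`'s hypothesis and every `h` with `Ψ h = θ_* [f]`:
  `Ψ h = 0`»;
* **`casselsTate_levelInputs_of_readout_vanishing`** — binder «for every such `f`, `h` and every `y ∈ Ш¹(K, E[m])`:
  `classBarInv(Φ⁻¹ y ∘ ∂h) = 0`» (`Φ = OpenLayer.extOneEquiv`, `∂` = `ExtPresentation.boundary` of the canonical presentation,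
  `classBarInv` = door-c4's invariant of `C̄`).  THIS is what the remaining steps deliver: S2-inst + S3 compute
  `classBarInv(Φ⁻¹ y ∘ ∂h) = ± (1/m²) · ∑_v inv_v[φ_v ∪ γ_v − H_v]` for the bridge's explicit admissible choice against `γ ∈ y`
  (memo §1 (iv)–(vi)), and transport + choice independence (S1 ✓ p633268 / S1′) + `hPTc`'s hypothesis make that sum vanish
  for `y ∈ Ш¹` (memo §1 (vii)).

Also `locClass_resOne_zero` (the zero `1`-cocycle is locally trivial — `hPTc`'s hypothesis is used at `g = 0`), and (§4, appended)
the twins of all of the above in the FLIPPED currency `θ′ : S ↦ desc(S, ·)` of `…ShaTwoCochainWeilTransport`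
(`PTChoice.exists_shaTwoConnecting_eq_map_descDual_flip`, `twoCocycleClass_eq_zero_iff_map_descDual_flip`,
`PTChoice.twoCocycleClass_eq_zero_of_shaTwoConnecting_eq_zero_flip`, **`casselsTate_levelInputs_of_readout_vanishing_flip`**).

THEOREMS ONLY (no definition, no instance, no named fact); reductions with a displayed hypothesis; no case of BSD, Poitou–Tate or
Cassels–Tate is proved here.  Width seat `bsd-wall-soed-p2-w4` g2 (the shell was announced by width seat w5 g2 at 12:45Z; landed by
w4 g2 after the 14:00Z hand-off deadline on the cell bus); `--supports stmt-BirchSwinnertonDyer-20480`, helper; route-free.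

## References
* [MilneADT2006] J. S. Milne, *Arithmetic Duality Theorems*, 2nd ed. (2006), Ch. I Thm. 4.10 (a) and its proof (pp. 57–58),
  Lemma 4.13, §6 Prop. 6.9, Thm. 6.13 (a) (p. 88).
* [CasselsFrohlichANT1967] J. W. S. Cassels, A. Fröhlich (eds.), *Algebraic Number Theory* (1967), Ch. VII §11.2 (bis).
* [Howard2004HeegnerKolyvagin] B. Howard, Compositio Math. 140 (2004), Thm. 2.1.11.
-/

noncomputable section

open scoped Classical
open Function NumberField IsDedekindDomain CategoryTheory CategoryTheory.Abelian
open scoped NumberField ContRepresentation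

-- `Summit.<P>.<Sub>` repeats `BirchSwinnertonDyer` by the tree's layout convention (D-0017)
set_option linter.dupNamespace false
set_option autoImplicit false

namespace Summit.BirchSwinnertonDyer.BirchSwinnertonDyer.Theorems.ShaTwoCochainTheta

open _root_.WeierstrassCurve Field
open Literature.NumberTheory.EllipticCurves
open Literature.NumberTheory.GaloisRepresentations Literature.NumberTheory.GaloisCohomology
open Literature.NumberTheory.GaloisRepresentations.DiscreteGaloisModule (mu MuCarrier pairing TateDual tateDual
  pairingDualHom pairingDualIntertwining sha shaTwo)
open Literature.Algebra.Homology Literature.Algebra.Homology.DiscreteRep Literature.Algebra.Homology.ExtPresentation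
open Literature.NumberTheory.GaloisRepresentations.IdeleClassBar (classBarD classBarInv)
open Literature.NumberTheory.GaloisRepresentations.HomDual (shaTwoConnecting)
open Literature.NumberTheory.GaloisRepresentations.FreePresentation (presentationComplex presentationComplex_shortExact)
open Literature.NumberTheory.GaloisRepresentations.OpenLayer (extOneEquiv)
open Summit.BirchSwinnertonDyer.BirchSwinnertonDyer.Theorems.SchneiderFreeAdditiveX3.PoitouTateReduction (exists_bidual_intertwining)

/-! ## §1 The zero `1`-cocycle is locally trivial -/

/-- `[res_v 0] = 0`: the zero `1`-cocycle is locally trivial at every place (so `hPTc`'s hypothesis may be used at `g = 0`).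
[folklore] -/
theorem locClass_resOne_zero {K : Type} [Field K] [NumberField K] {M : Type} [AddCommGroup M] [TopologicalSpace M]
    [DiscreteTopology M] (ρ : DiscreteGaloisModule K M) (v : Place K) :
    locClass ρ (Place.Completion v) (resOne ρ (Place.Completion v) 0) = 0 := by
  have h : resOne ρ (Place.Completion v) (0 : contOneCocycles ρ.toTopRep) = 0 :=
    Subtype.ext (ContinuousMap.ext fun _ => rfl)
  rw [h, locClass_eq]
  exact oneCocycleClass_zero _

/-! ## §2 `casselsTate_levelInputs K` from «`Ψ h = θ_* [f] ⟹ Ψ h = 0`» -/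

/-- **The shell, first form: `casselsTate_levelInputs K` ⟸ ONE displayed binder «for every `W/ℚ` elliptic, odd prime `p`,
`M₀ ≥ 1`, Weil-type alternating non-degenerate `e` on `E[p^{2M₀}]`, every `2`-cocycle `f` of `E[p^{M₀}]` with `hPTc`'s hypothesis,
and every `h : N₁ → C̄` with `Ψ h = θ_* [f]`: `Ψ h = 0`».**  Proof: `hPTc`'s hypothesis at the locally trivial `g = 0` gives an
admissible choice `C`; `C.twoCocycleClass_eq_zero_of_shaTwoConnecting_eq_zero` (p635669: exhaustion + `H²(θ)` injective); then
w3 g6's `casselsTate_levelInputs_of_shaTwoCochain`.  [cite: MilneADT2006, Ch. I, Thm. 4.10 (a) (proof, p. 58), §6 Thm. 6.13 (a) (p. 88)] -/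
theorem casselsTate_levelInputs_of_psi_eq_zero (K : Type) [Field K] [NumberField K]
    (hroad : ∀ (W : WeierstrassCurve ℚ) [W.IsElliptic] (p M₀ : ℕ), p.Prime → p ≠ 2 → 1 ≤ M₀ →
      ∀ [NeZero (p ^ M₀)] [NeZero (p ^ M₀ * p ^ M₀)] [Finite (geomTorsion (W.baseChange K) ((p ^ M₀ : ℕ) : ℤ))]
        (e : geomTorsion (W.baseChange K) ((p ^ M₀ * p ^ M₀ : ℕ) : ℤ) →
          geomTorsion (W.baseChange K) ((p ^ M₀ * p ^ M₀ : ℕ) : ℤ) → AlgebraicClosure K)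
        (hμ : ∀ S T, e S T ^ (p ^ M₀ * p ^ M₀) = 1)
        (hadd₁ : ∀ S₁ S₂ T, e (S₁ + S₂) T = e S₁ T * e S₂ T)
        (hadd₂ : ∀ S T₁ T₂, e S (T₁ + T₂) = e S T₁ * e S T₂)
        (hgal : ∀ (σ : absoluteGaloisGroup K)
          (S T : geomTorsion (W.baseChange K) ((p ^ M₀ * p ^ M₀ : ℕ) : ℤ)), σ • e S T = e (σ • S) (σ • T)),
        (∀ T, e T T = 1) → (∀ T, (∀ S, e S T = 1) → T = 0) →
        ∀ f : contTwoCocycles ((W.baseChange K).torsionGaloisModule ((p ^ M₀ : ℕ) : ℤ)).toTopRep,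
          (∀ g : contOneCocycles ((W.baseChange K).torsionGaloisModule ((p ^ M₀ : ℕ) : ℤ)).toTopRep,
            (∀ v : Place K, locClass ((W.baseChange K).torsionGaloisModule ((p ^ M₀ : ℕ) : ℤ))
                (Place.Completion v)
                (resOne ((W.baseChange K).torsionGaloisModule ((p ^ M₀ : ℕ) : ℤ)) (Place.Completion v) g) = 0) →
            ∃ (C : PTChoice (W.baseChange K) (p ^ M₀) e hμ hadd₁ hadd₂ hgal f g) (S : Finset (Place K)),
              (∀ v ∉ S, C.localTerm (LocalInvariants.canonical K (p ^ M₀ * p ^ M₀)) v = 0) ∧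
                ∑ v ∈ S, C.localTerm (LocalInvariants.canonical K (p ^ M₀ * p ^ M₀)) v = 0) →
          ∀ h : (presentationComplex ((W.baseChange K).torsionGaloisModule ((p ^ M₀ : ℕ) : ℤ))).X₁ ⟶ classBarD K,
            shaTwoConnecting ((W.baseChange K).torsionGaloisModule ((p ^ M₀ : ℕ) : ℤ)) (p ^ M₀ * p ^ M₀)
                (FirstCaseData.mul_nsmul_geomTorsion_eq_zero (W := W.baseChange K) (m := p ^ M₀)) h =
              galoisCohomology.map (pairingDualIntertwining
                (ρ₁ := (W.baseChange K).torsionGaloisModule ((p ^ M₀ : ℕ) : ℤ))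
                (ρ₂ := (W.baseChange K).torsionGaloisModule ((p ^ M₀ : ℕ) : ℤ))
                (B := descendHom (W.baseChange K) (p ^ M₀) (p ^ M₀) e hμ hadd₁ hadd₂)
                (descendHom_smul (W.baseChange K) (p ^ M₀) (p ^ M₀) e hμ hadd₁ hadd₂ hgal)) 2
                (twoCocycleClass _ f) →
            shaTwoConnecting ((W.baseChange K).torsionGaloisModule ((p ^ M₀ : ℕ) : ℤ)) (p ^ M₀ * p ^ M₀)
                (FirstCaseData.mul_nsmul_geomTorsion_eq_zero (W := W.baseChange K) (m := p ^ M₀)) h = 0) :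
    casselsTate_levelInputs K :=
  CasselsTateConj.casselsTate_levelInputs_of_shaTwoCochain K
    fun W _ p M₀ hp hp2 hM₀ _ e hμ hadd₁ hadd₂ hgal halt hnd f hf => by
      haveI : NeZero (p ^ M₀ * p ^ M₀) := ⟨mul_ne_zero (NeZero.ne _) (NeZero.ne _)⟩
      haveI : Finite (geomTorsion (W.baseChange K) ((p ^ M₀ : ℕ) : ℤ)) :=
        finite_geomTorsion_of_neZero (W.baseChange K) (p ^ M₀)
      obtain ⟨C, -, -⟩ := hf 0 fun v => locClass_resOne_zero _ v
      exact C.twoCocycleClass_eq_zero_of_shaTwoConnecting_eq_zero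
        (FirstCaseData.mul_nsmul_geomTorsion_eq_zero (W := W.baseChange K) (m := p ^ M₀)) hnd
        (hroad W p M₀ hp hp2 hM₀ e hμ hadd₁ hadd₂ hgal halt hnd f hf)

/-! ## §3 `casselsTate_levelInputs K` from «the readout functional of the exhausting `h` vanishes on `Ш¹(K, E[m])`» -/

/-- **THE SHELL: `casselsTate_levelInputs K` ⟸ ONE displayed binder «for every `W/ℚ` elliptic, odd prime `p`, `M₀ ≥ 1`,
Weil-type alternating non-degenerate `e`, every `2`-cocycle `f` of `E[p^{M₀}]` with `hPTc`'s hypothesis, every `h : N₁ → C̄`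
with `Ψ h = θ_* [f]`, and every `y ∈ Ш¹(K, E[p^{M₀}])`: `classBarInv(Φ⁻¹ y ∘ ∂h) = 0`».**  Here `Ψ = shaTwoConnecting` of the
canonical presentation `0 → N₁ → P → E[p^{M₀}] → 0` at level `p^{2M₀}`, `θ = desc^♭`, `Φ = OpenLayer.extOneEquiv` (door-c5),
`∂ = ExtPresentation.boundary`, `classBarInv` door-c4's invariant of `C̄`.  Proof: §2 + (vii-THR) with door-c5's bridge plugged
(`shaTwoConnecting_eq_zero_of_forall_sha_classBarInv_extOneEquiv_symm_eq_zero`, p638229) for a biduality pair from door-c4's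
`exists_bidual_intertwining`.  The binder is exactly what the bridge's invariant computation (memo §1 (iv)–(vi)) and the
transport/choice-independence step (§1 (vii), S1 p633268) deliver.
[cite: MilneADT2006, Ch. I, Thm. 4.10 (a) (proof, pp. 57–58), Lemma 4.13, §6 Thm. 6.13 (a) (p. 88)]
[cite: CasselsFrohlichANT1967, Ch. VII §11.2 (bis)] -/
theorem casselsTate_levelInputs_of_readout_vanishing (K : Type) [Field K] [NumberField K]
    (hbridge : ∀ (W : WeierstrassCurve ℚ) [W.IsElliptic] (p M₀ : ℕ), p.Prime → p ≠ 2 → 1 ≤ M₀ →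
      ∀ [NeZero (p ^ M₀)] [NeZero (p ^ M₀ * p ^ M₀)] [Finite (geomTorsion (W.baseChange K) ((p ^ M₀ : ℕ) : ℤ))]
        (e : geomTorsion (W.baseChange K) ((p ^ M₀ * p ^ M₀ : ℕ) : ℤ) →
          geomTorsion (W.baseChange K) ((p ^ M₀ * p ^ M₀ : ℕ) : ℤ) → AlgebraicClosure K)
        (hμ : ∀ S T, e S T ^ (p ^ M₀ * p ^ M₀) = 1)
        (hadd₁ : ∀ S₁ S₂ T, e (S₁ + S₂) T = e S₁ T * e S₂ T)
        (hadd₂ : ∀ S T₁ T₂, e S (T₁ + T₂) = e S T₁ * e S T₂)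
        (hgal : ∀ (σ : absoluteGaloisGroup K)
          (S T : geomTorsion (W.baseChange K) ((p ^ M₀ * p ^ M₀ : ℕ) : ℤ)), σ • e S T = e (σ • S) (σ • T)),
        (∀ T, e T T = 1) → (∀ T, (∀ S, e S T = 1) → T = 0) →
        ∀ f : contTwoCocycles ((W.baseChange K).torsionGaloisModule ((p ^ M₀ : ℕ) : ℤ)).toTopRep,
          (∀ g : contOneCocycles ((W.baseChange K).torsionGaloisModule ((p ^ M₀ : ℕ) : ℤ)).toTopRep,
            (∀ v : Place K, locClass ((W.baseChange K).torsionGaloisModule ((p ^ M₀ : ℕ) : ℤ))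
                (Place.Completion v)
                (resOne ((W.baseChange K).torsionGaloisModule ((p ^ M₀ : ℕ) : ℤ)) (Place.Completion v) g) = 0) →
            ∃ (C : PTChoice (W.baseChange K) (p ^ M₀) e hμ hadd₁ hadd₂ hgal f g) (S : Finset (Place K)),
              (∀ v ∉ S, C.localTerm (LocalInvariants.canonical K (p ^ M₀ * p ^ M₀)) v = 0) ∧
                ∑ v ∈ S, C.localTerm (LocalInvariants.canonical K (p ^ M₀ * p ^ M₀)) v = 0) →
          ∀ h : (presentationComplex ((W.baseChange K).torsionGaloisModule ((p ^ M₀ : ℕ) : ℤ))).X₁ ⟶ classBarD K,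
            shaTwoConnecting ((W.baseChange K).torsionGaloisModule ((p ^ M₀ : ℕ) : ℤ)) (p ^ M₀ * p ^ M₀)
                (FirstCaseData.mul_nsmul_geomTorsion_eq_zero (W := W.baseChange K) (m := p ^ M₀)) h =
              galoisCohomology.map (pairingDualIntertwining
                (ρ₁ := (W.baseChange K).torsionGaloisModule ((p ^ M₀ : ℕ) : ℤ))
                (ρ₂ := (W.baseChange K).torsionGaloisModule ((p ^ M₀ : ℕ) : ℤ))
                (B := descendHom (W.baseChange K) (p ^ M₀) (p ^ M₀) e hμ hadd₁ hadd₂)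
                (descendHom_smul (W.baseChange K) (p ^ M₀) (p ^ M₀) e hμ hadd₁ hadd₂ hgal)) 2
                (twoCocycleClass _ f) →
            ∀ y ∈ sha ((W.baseChange K).torsionGaloisModule ((p ^ M₀ : ℕ) : ℤ)),
              classBarInv K (((extOneEquiv ((W.baseChange K).torsionGaloisModule ((p ^ M₀ : ℕ) : ℤ))).symm y).comp
                (boundary (presentationComplex_shortExact ((W.baseChange K).torsionGaloisModule ((p ^ M₀ : ℕ) : ℤ)))
                  (classBarD K) h) (rfl : 1 + 1 = 2)) = 0) :
    casselsTate_levelInputs K :=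
  casselsTate_levelInputs_of_psi_eq_zero K
    fun W _ p M₀ hp hp2 hM₀ _ _ _ e hμ hadd₁ hadd₂ hgal halt hnd f hf h hh => by
      haveI : Finite (TateDual K (geomTorsion (W.baseChange K) ((p ^ M₀ : ℕ) : ℤ)) (p ^ M₀ * p ^ M₀)) :=
        DiscreteGaloisModule.TateDual.finite K _ _
      obtain ⟨ι, κ, hι, hκι, hικ⟩ := exists_bidual_intertwining (n := p ^ M₀ * p ^ M₀)
        ((W.baseChange K).torsionGaloisModule ((p ^ M₀ : ℕ) : ℤ))
        (FirstCaseData.mul_nsmul_geomTorsion_eq_zero (W := W.baseChange K) (m := p ^ M₀))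
      exact shaTwoConnecting_eq_zero_of_forall_sha_classBarInv_extOneEquiv_symm_eq_zero _ _ ι κ hι hκι hικ h
        (hbridge W p M₀ hp hp2 hM₀ e hμ hadd₁ hadd₂ hgal halt hnd f hf h hh)


/-! ## §4 The same in the FLIPPED currency `θ′ : S ↦ desc(S, ·)` of `…ShaTwoCochainWeilTransport`

`…WeilTransport` (w3 g7) transports admissible choices along the FLIPPED dual map
`θ′ = pairingDualHom (m·m) (descendHom …).flip` (so that `θ′(S)(T) = desc(S, T)` on the nose).  For `e` alternating and
non-degenerate `θ′` is again an isomorphism (`descDualHom_flip_bijective`, p635669), so every statement of §2–§3 has a `θ′`-twin;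
they are recorded here so that the final glue may pick either currency without sign bookkeeping. -/

section Flip

variable {K : Type} [Field K] [NumberField K] {W : WeierstrassCurve K} {m : ℕ} [NeZero m]
variable {e : geomTorsion W ((m * m : ℕ) : ℤ) → geomTorsion W ((m * m : ℕ) : ℤ) → AlgebraicClosure K}
  {hμ : ∀ S T, e S T ^ (m * m) = 1}
  {hadd₁ : ∀ S₁ S₂ T, e (S₁ + S₂) T = e S₁ T * e S₂ T}
  {hadd₂ : ∀ S T₁ T₂, e S (T₁ + T₂) = e S T₁ * e S T₂}
  {hgal : ∀ (σ : absoluteGaloisGroup K) (S T : geomTorsion W ((m * m : ℕ) : ℤ)), σ • e S T = e (σ • S) (σ • T)}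

/-- **`θ′_* [f] ∈ Ш²(K, E[m]^D)`** for the flipped dual map and a `2`-cocycle `f` with an admissible choice.
[cite: MilneADT2006, Ch. I §4 Thm. 4.10 (a)] -/
theorem _root_.Literature.NumberTheory.EllipticCurves.PTChoice.map_descDual_flip_twoCocycleClass_mem_shaTwo
    [Finite (geomTorsion W (m : ℤ))]
    {f : contTwoCocycles (W.torsionGaloisModule (m : ℤ)).toTopRep} {g : contOneCocycles (W.torsionGaloisModule (m : ℤ)).toTopRep}
    (C : PTChoice W m e hμ hadd₁ hadd₂ hgal f g) :
    galoisCohomology.map (pairingDualIntertwining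
        (ρ₁ := W.torsionGaloisModule (m : ℤ)) (ρ₂ := W.torsionGaloisModule (m : ℤ))
        (B := (descendHom W m m e hμ hadd₁ hadd₂).flip) (descendHom_flip_smul W m e hμ hadd₁ hadd₂ hgal)) 2
      (twoCocycleClass _ f) ∈ shaTwo ((W.torsionGaloisModule (m : ℤ)).tateDual (m * m)) :=
  PoitouTateShaTwoReadout.map_mem_shaTwo_real (pairingDualIntertwining
    (ρ₁ := W.torsionGaloisModule (m : ℤ)) (ρ₂ := W.torsionGaloisModule (m : ℤ))
    (B := (descendHom W m m e hμ hadd₁ hadd₂).flip) (descendHom_flip_smul W m e hμ hadd₁ hadd₂ hgal)) C.twoCocycleClass_mem_shaTwo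

/-- **Exhaustion in the flipped currency: `∃ h, Ψ h = θ′_* [f]`** at every number field `K` (as
`PTChoice.exists_shaTwoConnecting_eq_map_descDual`, for `θ′`). [cite: MilneADT2006, Ch. I Thm. 4.10 (a), proof p. 58, Lemma 4.13] -/
theorem _root_.Literature.NumberTheory.EllipticCurves.PTChoice.exists_shaTwoConnecting_eq_map_descDual_flip
    [Finite (geomTorsion W (m : ℤ))]
    {f : contTwoCocycles (W.torsionGaloisModule (m : ℤ)).toTopRep} {g : contOneCocycles (W.torsionGaloisModule (m : ℤ)).toTopRep}
    (C : PTChoice W m e hμ hadd₁ hadd₂ hgal f g) [NeZero (m * m)] (hM : ∀ T : geomTorsion W (m : ℤ), (m * m) • T = 0) :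
    ∃ h : (presentationComplex (W.torsionGaloisModule (m : ℤ))).X₁ ⟶ classBarD K,
      shaTwoConnecting (W.torsionGaloisModule (m : ℤ)) (m * m) hM h =
        galoisCohomology.map (pairingDualIntertwining
          (ρ₁ := W.torsionGaloisModule (m : ℤ)) (ρ₂ := W.torsionGaloisModule (m : ℤ))
          (B := (descendHom W m m e hμ hadd₁ hadd₂).flip) (descendHom_flip_smul W m e hμ hadd₁ hadd₂ hgal)) 2
          (twoCocycleClass _ f) :=
  IdeleReadout.exists_shaTwoConnecting_eq_of_localGlobalTwo (W.torsionGaloisModule (m : ℤ)) (m * m) hM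
    (PoitouTateShaTwoReadout.tateDual_localGlobal_real (W.torsionGaloisModule (m : ℤ)) (m * m) hM) _
    C.map_descDual_flip_twoCocycleClass_mem_shaTwo

/-- **`[f] = 0 ↔ θ′_* [f] = 0`** (`θ′` bijective for `e` alternating and non-degenerate). [cite: MilneADT2006, Ch. I Thm. 4.10 (a), Cor. 2.3] -/
theorem twoCocycleClass_eq_zero_iff_map_descDual_flip [Finite (geomTorsion W (m : ℤ))] (halt : ∀ T, e T T = 1)
    (hnd : ∀ T, (∀ S, e S T = 1) → T = 0) (f : contTwoCocycles (W.torsionGaloisModule (m : ℤ)).toTopRep) :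
    twoCocycleClass _ f = 0 ↔
      galoisCohomology.map (pairingDualIntertwining
        (ρ₁ := W.torsionGaloisModule (m : ℤ)) (ρ₂ := W.torsionGaloisModule (m : ℤ))
        (B := (descendHom W m m e hμ hadd₁ hadd₂).flip) (descendHom_flip_smul W m e hμ hadd₁ hadd₂ hgal)) 2
        (twoCocycleClass _ f) = 0 :=
  (galoisCohomology_map_eq_zero_iff_of_bijective (pairingDualIntertwining
    (ρ₁ := W.torsionGaloisModule (m : ℤ)) (ρ₂ := W.torsionGaloisModule (m : ℤ))
    (B := (descendHom W m m e hμ hadd₁ hadd₂).flip) (descendHom_flip_smul W m e hμ hadd₁ hadd₂ hgal))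
    (descDualHom_flip_bijective W m e hμ hadd₁ hadd₂ halt hnd) 2 (twoCocycleClass _ f)).symm

/-- **`hPTc`'s conclusion `[f] = 0` ⟸ `Ψ h = 0` for the `h` exhausting `θ′_* [f]`** (flipped twin of
`PTChoice.twoCocycleClass_eq_zero_of_shaTwoConnecting_eq_zero`). [cite: MilneADT2006, Ch. I Thm. 4.10 (a), proof p. 58] -/
theorem _root_.Literature.NumberTheory.EllipticCurves.PTChoice.twoCocycleClass_eq_zero_of_shaTwoConnecting_eq_zero_flip
    [Finite (geomTorsion W (m : ℤ))]
    {f : contTwoCocycles (W.torsionGaloisModule (m : ℤ)).toTopRep} {g : contOneCocycles (W.torsionGaloisModule (m : ℤ)).toTopRep}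
    (C : PTChoice W m e hμ hadd₁ hadd₂ hgal f g) [NeZero (m * m)]
    (hM : ∀ T : geomTorsion W (m : ℤ), (m * m) • T = 0) (halt : ∀ T, e T T = 1) (hnd : ∀ T, (∀ S, e S T = 1) → T = 0)
    (hΨ : ∀ h : (presentationComplex (W.torsionGaloisModule (m : ℤ))).X₁ ⟶ classBarD K,
        shaTwoConnecting (W.torsionGaloisModule (m : ℤ)) (m * m) hM h =
          galoisCohomology.map (pairingDualIntertwining
            (ρ₁ := W.torsionGaloisModule (m : ℤ)) (ρ₂ := W.torsionGaloisModule (m : ℤ))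
            (B := (descendHom W m m e hμ hadd₁ hadd₂).flip) (descendHom_flip_smul W m e hμ hadd₁ hadd₂ hgal)) 2
            (twoCocycleClass _ f) →
        shaTwoConnecting (W.torsionGaloisModule (m : ℤ)) (m * m) hM h = 0) :
    twoCocycleClass _ f = 0 := by
  obtain ⟨h, hh⟩ := C.exists_shaTwoConnecting_eq_map_descDual_flip hM
  rw [twoCocycleClass_eq_zero_iff_map_descDual_flip (hμ := hμ) (hadd₁ := hadd₁) (hadd₂ := hadd₂) (hgal := hgal) halt hnd f,
    ← hh]
  exact hΨ h hh

end Flip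

/-- **THE SHELL in the flipped currency: `casselsTate_levelInputs K` ⟸ «for every `f` with `hPTc`'s hypothesis, every `h` with
`Ψ h = θ′_* [f]` (`θ′ = pairingDualHom (p^{2M₀}) desc.flip`, the currency of `…WeilTransport`) and every `y ∈ Ш¹(K, E[p^{M₀}])`:
`classBarInv(Φ⁻¹ y ∘ ∂h) = 0`».**  Same proof as `casselsTate_levelInputs_of_readout_vanishing` with the flipped exhaustion.
[cite: MilneADT2006, Ch. I, Thm. 4.10 (a) (proof, pp. 57–58), Lemma 4.13, §6 Thm. 6.13 (a) (p. 88)]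
[cite: CasselsFrohlichANT1967, Ch. VII §11.2 (bis)] -/
theorem casselsTate_levelInputs_of_readout_vanishing_flip (K : Type) [Field K] [NumberField K]
    (hbridge : ∀ (W : WeierstrassCurve ℚ) [W.IsElliptic] (p M₀ : ℕ), p.Prime → p ≠ 2 → 1 ≤ M₀ →
      ∀ [NeZero (p ^ M₀)] [NeZero (p ^ M₀ * p ^ M₀)] [Finite (geomTorsion (W.baseChange K) ((p ^ M₀ : ℕ) : ℤ))]
        (e : geomTorsion (W.baseChange K) ((p ^ M₀ * p ^ M₀ : ℕ) : ℤ) →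
          geomTorsion (W.baseChange K) ((p ^ M₀ * p ^ M₀ : ℕ) : ℤ) → AlgebraicClosure K)
        (hμ : ∀ S T, e S T ^ (p ^ M₀ * p ^ M₀) = 1)
        (hadd₁ : ∀ S₁ S₂ T, e (S₁ + S₂) T = e S₁ T * e S₂ T)
        (hadd₂ : ∀ S T₁ T₂, e S (T₁ + T₂) = e S T₁ * e S T₂)
        (hgal : ∀ (σ : absoluteGaloisGroup K)
          (S T : geomTorsion (W.baseChange K) ((p ^ M₀ * p ^ M₀ : ℕ) : ℤ)), σ • e S T = e (σ • S) (σ • T)),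
        (∀ T, e T T = 1) → (∀ T, (∀ S, e S T = 1) → T = 0) →
        ∀ f : contTwoCocycles ((W.baseChange K).torsionGaloisModule ((p ^ M₀ : ℕ) : ℤ)).toTopRep,
          (∀ g : contOneCocycles ((W.baseChange K).torsionGaloisModule ((p ^ M₀ : ℕ) : ℤ)).toTopRep,
            (∀ v : Place K, locClass ((W.baseChange K).torsionGaloisModule ((p ^ M₀ : ℕ) : ℤ))
                (Place.Completion v)
                (resOne ((W.baseChange K).torsionGaloisModule ((p ^ M₀ : ℕ) : ℤ)) (Place.Completion v) g) = 0) →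
            ∃ (C : PTChoice (W.baseChange K) (p ^ M₀) e hμ hadd₁ hadd₂ hgal f g) (S : Finset (Place K)),
              (∀ v ∉ S, C.localTerm (LocalInvariants.canonical K (p ^ M₀ * p ^ M₀)) v = 0) ∧
                ∑ v ∈ S, C.localTerm (LocalInvariants.canonical K (p ^ M₀ * p ^ M₀)) v = 0) →
          ∀ h : (presentationComplex ((W.baseChange K).torsionGaloisModule ((p ^ M₀ : ℕ) : ℤ))).X₁ ⟶ classBarD K,
            shaTwoConnecting ((W.baseChange K).torsionGaloisModule ((p ^ M₀ : ℕ) : ℤ)) (p ^ M₀ * p ^ M₀)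
                (FirstCaseData.mul_nsmul_geomTorsion_eq_zero (W := W.baseChange K) (m := p ^ M₀)) h =
              galoisCohomology.map (pairingDualIntertwining
                (ρ₁ := (W.baseChange K).torsionGaloisModule ((p ^ M₀ : ℕ) : ℤ))
                (ρ₂ := (W.baseChange K).torsionGaloisModule ((p ^ M₀ : ℕ) : ℤ))
                (B := (descendHom (W.baseChange K) (p ^ M₀) (p ^ M₀) e hμ hadd₁ hadd₂).flip)
                (descendHom_flip_smul (W.baseChange K) (p ^ M₀) e hμ hadd₁ hadd₂ hgal)) 2
                (twoCocycleClass _ f) →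
            ∀ y ∈ sha ((W.baseChange K).torsionGaloisModule ((p ^ M₀ : ℕ) : ℤ)),
              classBarInv K (((extOneEquiv ((W.baseChange K).torsionGaloisModule ((p ^ M₀ : ℕ) : ℤ))).symm y).comp
                (boundary (presentationComplex_shortExact ((W.baseChange K).torsionGaloisModule ((p ^ M₀ : ℕ) : ℤ)))
                  (classBarD K) h) (rfl : 1 + 1 = 2)) = 0) :
    casselsTate_levelInputs K :=
  CasselsTateConj.casselsTate_levelInputs_of_shaTwoCochain K
    fun W _ p M₀ hp hp2 hM₀ _ e hμ hadd₁ hadd₂ hgal halt hnd f hf => by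
      haveI : NeZero (p ^ M₀ * p ^ M₀) := ⟨mul_ne_zero (NeZero.ne _) (NeZero.ne _)⟩
      haveI : Finite (geomTorsion (W.baseChange K) ((p ^ M₀ : ℕ) : ℤ)) :=
        finite_geomTorsion_of_neZero (W.baseChange K) (p ^ M₀)
      haveI : Finite (TateDual K (geomTorsion (W.baseChange K) ((p ^ M₀ : ℕ) : ℤ)) (p ^ M₀ * p ^ M₀)) :=
        DiscreteGaloisModule.TateDual.finite K _ _
      obtain ⟨C, -, -⟩ := hf 0 fun v => locClass_resOne_zero _ v
      obtain ⟨ι, κ, hι, hκι, hικ⟩ := exists_bidual_intertwining (n := p ^ M₀ * p ^ M₀)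
        ((W.baseChange K).torsionGaloisModule ((p ^ M₀ : ℕ) : ℤ))
        (FirstCaseData.mul_nsmul_geomTorsion_eq_zero (W := W.baseChange K) (m := p ^ M₀))
      exact C.twoCocycleClass_eq_zero_of_shaTwoConnecting_eq_zero_flip
        (FirstCaseData.mul_nsmul_geomTorsion_eq_zero (W := W.baseChange K) (m := p ^ M₀)) halt hnd
        fun h hh => shaTwoConnecting_eq_zero_of_forall_sha_classBarInv_extOneEquiv_symm_eq_zero _ _ ι κ hι hκι hικ h
          (hbridge W p M₀ hp hp2 hM₀ e hμ hadd₁ hadd₂ hgal halt hnd f hf h hh)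

end Summit.BirchSwinnertonDyer.BirchSwinnertonDyer.Theorems.ShaTwoCochainTheta

end
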